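import Summits.Ventures.HSemireg.Pad4TowerPsiLine

/-!
# Venture HSemireg — PAD-4 on 𝔅(μ₄): THE DIAMOND UNIVERSE ◇_h — the letter table of the W-SEARCH legs (`◇₈` = the 15 types ∕ 45 letters
# `{(t, c) : t even, t + 2c ≤ 8} × μ₄`) as a decidable predicate on factor points and configurations — DEF-ONLY + `decide` counts
# (bc5-plan g7 LINE 5 SEED TEMPLATE v0.1, definition request (D-univ) «`InUniverse D8 C` on the 15-type ∕ 45-letter table»)

HONEST FRAMING. Lean index of the computation cell `pub-hsemireg` (S4-PUSH, H2 door PAD-4), typed by the Ventures-side typer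
`hodge-lit-semireg-typer-2` (g5; line of record stmt-HodgeConjecture-18881 `Cruxes/BlochSeedDiscOne/Lines/birth.lean` 814a6a70c14e831a,
stub `stub_rung_pad4_seedAt`). WHAT THIS FILE IS: the UNIVERSE in which the cell's W-SEARCH SAT legs live (◇₆ ∕ ◇₈ ∕ ◇₁₀: «causal height ≤ h over a
floor node»), typed so that a K-free LINE 5 statement «every static-clean G₁-closed support IN ◇₈ …» (bc5-plan g7 LINE5-SEEDS-TEMPLATE.md
35a591490aa3302d §1, definition request (D-univ)) can name it. SOURCE OF RECORD for the table: s4-search-1 g24's run script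
`run_attrbatch_D8.sh` (code∕g24∕wg1∕, SHA256SUMS there): `U=0.0,0.1,0.2,0.3,0.4,2.0,2.1,2.2,2.3,4.0,4.1,4.2,6.0,6.1,8.0` = the fifteen types `(t, c)`,
and `xres2s.py` v19 c7ee80d7dccc0bfd `letters_from_types`: type `(t, c)` ↦ the letter `O`-translate `(α, β) = (t + c, c·z)`, `z ∈ μ₄` (one
letter if `c = 0`, four if `c > 0`): 5 node types + 10 charged types = 45 letters; pool `2·45⁴ = 8 201 250` classes (the in-log gate of every ◇₈
job, e.g. j298438 ∕ j302131). In the frame (`BPoint = (α, Re β, Im β)`, `ray`, (J) `AxisPt`, (F) `chargeOf`): the letter of type `(t, c)` and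
phase `k` is `ray (t, 0, 0) k c` (`t·I + c·ℓ_{i^k}`: `O, cℓ, 2I + cℓ = towers, …`), and `◇_h = {x : β on an axis or 0, t := α − |β| ≥ 0 even,
α + |β| ≤ h}` (`|β| = |chargeOf|` on axis letters). The CEILING LINE of (P) `Pad4TowerPsiLine` ∕ g52's Ψ-LINE note is `α + |β| = h`
(types `8I, 6I+ℓ, 4I+2ℓ, 2I+3ℓ, 4ℓ` at `h = 8`), the FLOOR LINE is `t = 0` (pure rays and `O`).

CONTENT (DEF-ONLY + `decide` facts; nothing about designs is claimed).
* `absCharge x` (`|chargeOf x|` = the charge `c = |β|` of an axis letter), `InDiamond h x`, `MCell.InDiamond h Z` (all four letters),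
  `MConfig.InDiamond h C` (all cells of both levels) — decidable; `OnCeiling h x` (`α + c = h`), `OnFloor x` (`α = c`).
* `diamondLetter t c k := ray (t, 0, 0) k c` and **`inDiamond_letter`**: every table letter lies in `◇₈` (the 15 types × 4 phases, `decide`);
  **`diamond_card`** (`boxCount` over the box `0 ≤ α ≤ 10, |Re β|, |Im β| ≤ 5`, which holds every `◇_h` letter for `h ≤ 10` by `inDiamond_bounds`):
  exactly **45** points satisfy `InDiamond 8` (so `◇₈` IS the 45-letter table — `inDiamond_table` gives the converse point by point), of which **5** are
  nodes, **17** lie on the ceiling line and **17** on the floor line (`O` and the 4+4+4+4 rays `cℓ_u`, `c = 1…4`); **28** satisfy `InDiamond 6` (`◇₆`,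
  2·28⁴ = 1 229 312) and **66** satisfy `InDiamond 10` (`◇₁₀`, 2·66⁴ = 37 949 472, the G₁-leg pool of j298438); `d8Types` (the fifteen types).
* `cuCell_inDiamond` ((P)'s ceiling unit cell `[6I+ℓ_u]⁴` lies in `◇₈`, on the ceiling).

WHAT IS NOT HERE ∕ NOT IN LEAN. `M*(◇_h)` (the RULE-D∕FC1 greatest model in which the SAT legs actually search), G₁-orbits, Burnside counts of
orbits (97 660 ∕ 433 002), any static rule, any K-free statement, any SAT verdict; nothing here is an object or a census row. NOTHING HERE SAYS
THAT HC ∕ HC_CM ∕ HC_AV ∕ W₆ ∕ HC_Kum4Type HOLDS OR FAILS. No `instance`, no notation, no named fact, 0 `sorry`.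

SOURCES (sha16 ∕ bus): run_attrbatch_D8.sh (s4push∕search-1∕code∕g24∕wg1∕, `U=` line) + xres2s.py v19 c7ee80d7dccc0bfd `letters_from_types` ∕ `UN`;
bc5-plan g7 LINE5-SEEDS-TEMPLATE.md 35a591490aa3302d (D-univ), cell INBOX l.32395; gate logs «8 201 250 classes» (j302131, l.32378), «37 949 472»
(j298438, l.32299); (J) `Pad4TowerFCCoreParitySeam.lean` p612407 (`AxisPt`), (F) `Pad4TowerFCCoreSeam.lean` p603640 (`chargeOf`), (P)
`Pad4TowerPsiLine.lean` p623410 (`cuCell`). -/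

namespace Summit.Ventures.HSemireg.Pad4Tower

open Finset

/-! ## §1 The diamond predicate -/

/-- the CHARGE `c = |β|` of an axis letter, written with (F)'s signed charge: `|chargeOf x|` (`= |Re β − Im β|`; on an axis letter exactly one of
`Re β`, `Im β` is non-zero). -/
abbrev absCharge (x : BPoint) : ℤ := |chargeOf x|

/-- **`x ∈ ◇_h`**: `β` on a coordinate axis or zero (a μ₄ letter), node level `t := α − c ≥ 0` EVEN, and causal height `α + c ≤ h` — the letter
`t·I + c·ℓ_u` of the W-SEARCH universe of height `h` (`h = 8`: the 15 types `(t,c)`, `t ∈ {0,2,4,6,8}`, `t + 2c ≤ 8`). Decidable. -/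
abbrev InDiamond (h : ℤ) (x : BPoint) : Prop :=
  (x.2 = (0, 0) ∨ AxisPt x) ∧ absCharge x ≤ x.1 ∧ (x.1 - absCharge x) % 2 = 0 ∧ x.1 + absCharge x ≤ h

/-- a cell lies in `◇_h`: all four letters do. -/
abbrev MCell.InDiamond (h : ℤ) (Z : MCell) : Prop := ∀ f, Pad4Tower.InDiamond h (Z f)

/-- a configuration lies in `◇_h`: every cell of both levels does («support in ◇_h»). -/
abbrev MConfig.InDiamond (h : ℤ) (C : MConfig) : Prop :=
  (∀ Z ∈ C.lower, MCell.InDiamond h Z) ∧ ∀ P ∈ C.upper, MCell.InDiamond h P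

/-- the CEILING LINE of height `h`: `α + c = h` (own light-cone coordinate `a = h∕2`; at `h = 8`: `8I, 6I+ℓ, 4I+2ℓ, 2I+3ℓ, 4ℓ`). -/
abbrev OnCeiling (h : ℤ) (x : BPoint) : Prop := x.1 + absCharge x = h

/-- the FLOOR LINE: `α = c` (`t = 0`: the pure rays `cℓ_u` and `O`). -/
abbrev OnFloor (x : BPoint) : Prop := x.1 = absCharge x

/-- the table letter of type `(t, c)` and phase `k`: `t·I + c·ℓ_{i^k} = ray (t, 0, 0) k c` (xres2s `letters_from_types`: `(α, β) = (t + c, c·z_k)`). -/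
abbrev diamondLetter (t c : ℤ) (k : Fin 4) : BPoint := ray (t, 0, 0) k c

/-! ## §2 The table IS the predicate (`decide`) -/

/-- the fifteen types `(t, c)` of `◇₈` (run_attrbatch_D8.sh `U=0.0,0.1,0.2,0.3,0.4,2.0,2.1,2.2,2.3,4.0,4.1,4.2,6.0,6.1,8.0`). -/
def d8Types : List (ℤ × ℤ) :=
  [(0, 0), (0, 1), (0, 2), (0, 3), (0, 4), (2, 0), (2, 1), (2, 2), (2, 3), (4, 0), (4, 1), (4, 2), (6, 0), (6, 1), (8, 0)]

/-- **EVERY LETTER OF THE ◇₈ TABLE LIES IN `◇₈`** (the fifteen types in all four phases), and the table has 5 node types + 10 charged types,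
i.e. `5 + 4·10 = 45` letters. [kernel, `decide`] -/
theorem inDiamond_letter :
    (∀ k : Fin 4, ∀ p ∈ d8Types, InDiamond 8 (diamondLetter p.1 p.2 k)) ∧ d8Types.length = 15 ∧
      (d8Types.filter fun p => p.2 = 0).length = 5 ∧ (d8Types.filter fun p => p.2 ≠ 0).length = 10 := by
  refine ⟨?_, by decide, by decide, by decide⟩
  decide

/-- the number of points of the box `0 ≤ α ≤ 10`, `−5 ≤ Re β, Im β ≤ 5` (which contains every `◇_h` letter, `h ≤ 10`: `inDiamond_bounds`)
satisfying a decidable predicate. -/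
def boxCount (P : BPoint → Prop) [DecidablePred P] : ℕ :=
  ∑ a : Fin 11, ∑ b : Fin 11, ∑ c : Fin 11, if P ((a : ℤ), (b : ℤ) - 5, (c : ℤ) - 5) then 1 else 0

/-- every `◇_h` letter has `0 ≤ α ≤ h` and `2|Re β|, 2|Im β| ≤ h` (so for `h ≤ 10` it lies in the box of `boxCount`). -/
theorem inDiamond_bounds {h : ℤ} {x : BPoint} (hx : InDiamond h x) :
    0 ≤ x.1 ∧ x.1 ≤ h ∧ 2 * |x.2.1| ≤ h ∧ 2 * |x.2.2| ≤ h := by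
  obtain ⟨α, b1, b2⟩ := x
  obtain ⟨hax, hc, -, hα⟩ := hx
  simp only [absCharge, chargeOf] at hc hα
  have hb : |b1| + |b2| = |b1 - b2| := by
    rcases hax with h0 | ⟨-, h2⟩ | ⟨h1, -⟩
    · simp only [Prod.mk.injEq] at h0; simp [h0.1, h0.2]
    · simp only at h2; simp [h2]
    · simp only at h1; simp [h1]
  have h1 := abs_nonneg b1
  have h2 := abs_nonneg b2
  simp only
  refine ⟨by linarith [abs_nonneg (b1 - b2)], by linarith, by linarith, by linarith⟩

/-- **`◇₈` HAS EXACTLY 45 LETTERS** (pool `2·45⁴ = 8 201 250` classes), of which 5 are nodes (`O, 2I, 4I, 6I, 8I`), 17 lie on the ceiling line and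
17 on the floor line; **`◇₆` has 28** (`2·28⁴ = 1 229 312`) and **`◇₁₀` has 66** (`2·66⁴ = 37 949 472`, the G₁-leg pool of j298438).
[kernel, `decide` over the box] -/
theorem diamond_card :
    boxCount (InDiamond 8) = 45 ∧ boxCount (fun x => InDiamond 8 x ∧ x.2 = (0, 0)) = 5 ∧
      boxCount (fun x => InDiamond 8 x ∧ OnCeiling 8 x) = 17 ∧ boxCount (fun x => InDiamond 8 x ∧ OnFloor x) = 17 ∧
      boxCount (InDiamond 6) = 28 ∧ boxCount (InDiamond 10) = 66 ∧
      2 * 45 ^ 4 = 8201250 ∧ 2 * 28 ^ 4 = 1229312 ∧ 2 * 66 ^ 4 = 37949472 := by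
  refine ⟨by decide +kernel, by decide +kernel, by decide +kernel, by decide +kernel, by decide +kernel, by decide +kernel, by norm_num,
    by norm_num, by norm_num⟩

/-- every `◇₈` point of the box is a table letter `ray (t,0,0) k c`, `(t, c) ∈ d8Types` (the converse of `inDiamond_letter`: the predicate adds
nothing to the table). [kernel, `decide` over the box] -/
theorem inDiamond_table :
    ∀ a b c : Fin 11, InDiamond 8 ((a : ℤ), (b : ℤ) - 5, (c : ℤ) - 5) →
      ∃ k : Fin 4, ∃ p ∈ d8Types, ((a : ℤ), (b : ℤ) - 5, (c : ℤ) - 5) = diamondLetter p.1 p.2 k := by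
  decide +kernel

/-! ## §3 Link to (P): the ceiling unit cell lies in `◇₈`, on the ceiling -/

/-- (P)'s ceiling unit cell `[6I+ℓ_u]⁴` (the FC shape of the static-clean ◇₈ survivors) lies in `◇₈` with every letter on the ceiling line, and
(P)'s off-line cell `[4I|ℓ|ℓ|ℓ]` lies in `◇₈` too (floor letters `ℓ` + the node `4I`, neither all-ceiling nor all-floor). [kernel, `decide`] -/
theorem cuCell_inDiamond :
    cuCell.InDiamond 8 ∧ (∀ f, OnCeiling 8 (cuCell f)) ∧ offCell.InDiamond 8 ∧ ¬ (∀ f, OnCeiling 8 (offCell f)) ∧ ¬ (∀ f, OnFloor (offCell f)) := by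
  refine ⟨by decide, by decide, by decide, by decide, by decide⟩

end Summit.Ventures.HSemireg.Pad4Tower
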